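import Mathlib
import HarnessLib
import Summits.HubbardSuperconductivity.HubbardSuperconductivity.Theorems.KLProgrammeC4aValueBridgeGeometry

/-!
# Route `KLProgramme` — crux C4a, value layer (L3-val): the PRINCIPAL-VALUE bound AT FIXED LEVEL — the loop-angle integral of
# `DB(S_σ(φ))[J·∂_σS_σ]` for an EVEN pair-momentum vertex with two-inverse-power Fréchet majorants is bounded by a `Λ`-FREE constant

Cell `gate-hubbard-kl`, lane hubbard-kl-k3c3-p3 (g14); helper for stub (C) `stub_twoLeg_curvature` of the engine-flow child `KLRegimeEngineV17F2`
(stmt-HubbardSuperconductivity-20437), `k = 0` VALUE clause (located risk #12 «(C)-VALUE-K0»; (L3-val) input (ii) of HOME/hubbard-kl-c4a-1/C4A-PLAN.md §22.3).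
Second file of the «(L3-val)-EVEN-BRIDGE» bundle (`…C4aValueBridgeGeometry` = the chart geometry; `…C4aValueBridge` = the assembly into the `hd` of
`…C4aTadpoleValueAssembly.norm_sum_tubeTadpoles_le_of_oddDiff`).

THE ESTIMATE.  Data: `B : Momentum → ℂ` of class `C²`, EVEN (`B(−p) = B(p)`), with `‖DB(p)‖ ≤ cb₁·(max(c′‖p‖, Λ))⁻¹` and `‖D²B(p)‖ ≤ cb₂·(max(c′‖p‖, Λ))⁻²`
(`0 < c′`, `0 < Λ`; the scale-resolved particle–particle / particle–hole bubbles — `Λ` is the scale, and NOTHING below depends on it).  For levels `|s₀|, |σ| < r`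
of the tube and every base angle `θ`, with `S_σ(φ) := S_{σ,π+φ,θ}(0) = Φ(0,θ) + Φ(σ,π+φ+θ)` (Cooper angle at `φ = 0`) and the weight
`W(φ) := J(s₀, π+φ+θ) • ∂_σS_σ(φ)` (`∂_σS_σ(φ) = toLp(∂_μu(σ,π+φ+θ)•dir(π+φ+θ))`, `…Geometry.hasDerivAt_pairSumPath_level`):
  `‖∫_{(−π,π)} DB(S_σ(φ))[W(φ)] dφ‖ ≤ valuePVConst A A₃ A₄ r cb₁ cb₂ c′`            (`norm_setIntegral_fderiv_pairSumPath_le`).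
Proof (§3): symmetrise `φ ↔ −φ`; evenness gives `DB(S_σ(−φ)) = −DB(S_σ(φ) − Δ′)` with the reflection defect `Δ′ = S_σ(φ) + S_σ(−φ)`
(`‖Δ′‖ ≤ 2|σ|/(Dt−2A) + 2msD₂φ²`), so `f(φ) + f(−φ) = (DB(S₊) − DB(S₊ − Δ′))[W₋] + DB(S₊)[W₊ − W₋]`: on the middle window `κ₀|σ| ≤ |φ| ≤ φ₀` the first
term costs `cb₂·(c′c|φ|/2)⁻²·‖Δ′‖·W₀` (mean value for `DB` on the reflection segment, which stays `≥ c|φ|/2` from the Cooper point) and the second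
`cb₁(c′c|φ|)⁻¹·L_W·2|φ|`; near (`|φ| ≤ κ₀|σ|`) and far (`|φ| ≥ φ₀`) the direct bound `cb₁W₀/max(c′c(|σ|+|φ|), Λ)` is used.  All three are dominated
a.e. by `A₀ + A₁·a/(φ² + a²)`, `a = κ₀|σ|`, whose integral is `≤ 2πA₀ + πA₁` — free of `σ` AND of `Λ`.

* §0 evenness ⇒ `DB(−p) = −DB(p)`; the Cauchy kernel `a/(φ²+a²)` (integral `≤ π`) and its two lower bounds; the CONSTANTS (defs `valueBridgeW0/LW/Kappa/Phi0`,
  `valuePVConst`);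
* §1 the weight: `‖W(φ)‖ ≤ valueBridgeW0`, `‖W(φ) − W(φ′)‖ ≤ valueBridgeLW·|φ − φ′|`, continuity;
* §2 pointwise bounds of `f(φ) = DB(S_σ(φ))[W(φ)]`: lower comparability at `π + φ`, the paired bound on the middle window;
* §3 the a.e. domination and the theorem.

Pure real analysis on the tree's chart objects; `Λ`, `cb₁`, `cb₂`, `c′` are parameters; nothing about the Hubbard model's sizes; nothing asserts superconductivity.
References: BGM 2006 §2.4 (2.36) [cite: BenfattoGiulianiMastropietro2006]; FST II CPAM 51 (1998) §3.
-/

noncomputable section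

namespace Summit.HubbardSuperconductivity.HubbardSuperconductivity.Theorems.C4a

set_option linter.dupNamespace false -- summit = problem name (single-conjunct summit), D-0017

open Real Set MeasureTheory Filter
open scoped ContDiff Topology
open Literature.MathematicalPhysics.QuantumLattice Literature.MathematicalPhysics.QuantumLattice.BandSectorCounting Literature.Probability.LatticeModels
open Summit.HubbardSuperconductivity.HubbardSuperconductivity.Theorems.KLRegimeSplit
open Summit.HubbardSuperconductivity.HubbardSuperconductivity.Theorems.DispersionFlow
open Summit.HubbardSuperconductivity.HubbardSuperconductivity.Theorems.PerturbedFermiCurve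

/-! ## §0 Evenness and the derivative; the Cauchy kernel; the constants -/

/-- **An even `C¹` function has an odd derivative**: `B(−p) = B(p)` for all `p` ⇒ `DB(−p) = −DB(p)`. -/
theorem fderiv_neg_of_even {Bf : Momentum → ℂ} (hB : Differentiable ℝ Bf) (heven : ∀ p, Bf (-p) = Bf p) (p : Momentum) :
    fderiv ℝ Bf (-p) = -fderiv ℝ Bf p := by
  have hcomp : Bf ∘ (fun q : Momentum => -q) = Bf := funext fun q => heven q
  have hneg : HasFDerivAt (fun q : Momentum => -q) (-(ContinuousLinearMap.id ℝ Momentum)) p := (hasFDerivAt_id p).neg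
  have h1 : HasFDerivAt (Bf ∘ fun q : Momentum => -q) ((fderiv ℝ Bf (-p)).comp (-(ContinuousLinearMap.id ℝ Momentum))) p :=
    (hB (-p)).hasFDerivAt.comp p hneg
  rw [hcomp] at h1
  have h2 : fderiv ℝ Bf p = -fderiv ℝ Bf (-p) := by rw [h1.fderiv]; ext v; simp
  rw [h2, neg_neg]

/-- **The Cauchy kernel integrates to at most `π` over the window**: for `0 < a`, `∫_{(−π,π)} a/(φ² + a²) dφ ≤ π` (`= π` over `ℝ`). -/
theorem setIntegral_cauchyKernel_le {a : ℝ} (ha : 0 < a) : ∫ φ in Ioo (-π) π, a / (φ ^ 2 + a ^ 2) ≤ π := by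
  have hfun : (fun φ : ℝ => a / (φ ^ 2 + a ^ 2)) = fun φ => a⁻¹ * (1 + (φ / a) ^ 2)⁻¹ := by
    funext φ
    have ha' : a ≠ 0 := ha.ne'
    field_simp
    ring
  have hint : Integrable (fun φ : ℝ => a / (φ ^ 2 + a ^ 2)) := by
    rw [hfun]
    exact (integrable_inv_one_add_sq.comp_div ha.ne').const_mul a⁻¹
  have hnn : ∀ φ : ℝ, 0 ≤ a / (φ ^ 2 + a ^ 2) := fun φ => by positivity
  have htot : ∫ φ : ℝ, a / (φ ^ 2 + a ^ 2) = π := by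
    rw [hfun, integral_const_mul, Measure.integral_comp_div (fun x : ℝ => (1 + x ^ 2)⁻¹) a, integral_univ_inv_one_add_sq,
      abs_of_pos ha, smul_eq_mul, ← mul_assoc, inv_mul_cancel₀ ha.ne', one_mul]
  calc ∫ φ in Ioo (-π) π, a / (φ ^ 2 + a ^ 2) ≤ ∫ φ : ℝ, a / (φ ^ 2 + a ^ 2) :=
      setIntegral_le_integral hint (Eventually.of_forall hnn)
    _ = π := htot

/-- The Cauchy kernel dominates `1/(2a)` on the core `|φ| ≤ a`. -/
theorem inv_le_cauchyKernel_of_abs_le {a φ : ℝ} (ha : 0 < a) (h : |φ| ≤ a) : 1 / (2 * a) ≤ a / (φ ^ 2 + a ^ 2) := by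
  have hφ : φ ^ 2 ≤ a ^ 2 := by have h' := pow_le_pow_left₀ (abs_nonneg _) h 2; rwa [sq_abs] at h'
  rw [div_le_div_iff₀ (by positivity) (by positivity)]
  nlinarith

/-- The Cauchy kernel dominates `a/(2φ²)` on the tail `a ≤ |φ|`. -/
theorem div_sq_le_cauchyKernel_of_le_abs {a φ : ℝ} (ha : 0 < a) (h : a ≤ |φ|) : a / (2 * φ ^ 2) ≤ a / (φ ^ 2 + a ^ 2) := by
  have hφ : a ^ 2 ≤ φ ^ 2 := by have h' := pow_le_pow_left₀ ha.le h 2; rwa [sq_abs] at h'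
  have hφ0 : 0 < φ ^ 2 := lt_of_lt_of_le (by positivity) hφ
  exact div_le_div_of_nonneg_left ha.le (by positivity) (by linarith)

/-- Sup bound of the weight `W = J • ∂_σS`: `π√2/(Dt_min − 2A)²` (standard band bundle). -/
def valueBridgeW0 (A : ℝ) : ℝ :=
  π * Real.sqrt 2 / ((bandBounds (show (-4 : ℝ) < -1.1 by norm_num) (show (-1.1 : ℝ) ≤ -0.1 by norm_num) (show (-0.1 : ℝ) < 0 by norm_num)).Dtmin -
    2 * A) ^ 2

/-- Angular Lipschitz constant of the weight: `klJacG₁·(Dt−2A)⁻¹ + (π√2/(Dt−2A))·(klJacG₁/u_min + (π√2/(Dt−2A))·klJacR1/u_min² + (Dt−2A)⁻¹)`. -/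
def valueBridgeLW (A A₃ : ℝ) : ℝ :=
  klJacG ((bandBounds (show (-4 : ℝ) < -1.1 by norm_num) (show (-1.1 : ℝ) ≤ -0.1 by norm_num) (show (-0.1 : ℝ) < 0 by norm_num)).Dtmin) A A₃ 1 *
      ((bandBounds (show (-4 : ℝ) < -1.1 by norm_num) (show (-1.1 : ℝ) ≤ -0.1 by norm_num) (show (-0.1 : ℝ) < 0 by norm_num)).Dtmin - 2 * A)⁻¹ +
    π * Real.sqrt 2 / ((bandBounds (show (-4 : ℝ) < -1.1 by norm_num) (show (-1.1 : ℝ) ≤ -0.1 by norm_num) (show (-0.1 : ℝ) < 0 by norm_num)).Dtmin -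
        2 * A) *
      (klJacG ((bandBounds (show (-4 : ℝ) < -1.1 by norm_num) (show (-1.1 : ℝ) ≤ -0.1 by norm_num) (show (-0.1 : ℝ) < 0 by norm_num)).Dtmin) A A₃ 1 /
            (bandBounds (show (-4 : ℝ) < -1.1 by norm_num) (show (-1.1 : ℝ) ≤ -0.1 by norm_num) (show (-0.1 : ℝ) < 0 by norm_num)).umin +
          π * Real.sqrt 2 / ((bandBounds (show (-4 : ℝ) < -1.1 by norm_num) (show (-1.1 : ℝ) ≤ -0.1 by norm_num) (show (-0.1 : ℝ) < 0 by norm_num)).Dtmin -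
              2 * A) *
            klJacR1 ((bandBounds (show (-4 : ℝ) < -1.1 by norm_num) (show (-1.1 : ℝ) ≤ -0.1 by norm_num) (show (-0.1 : ℝ) < 0 by norm_num)).Dtmin) A /
            (bandBounds (show (-4 : ℝ) < -1.1 by norm_num) (show (-1.1 : ℝ) ≤ -0.1 by norm_num) (show (-0.1 : ℝ) < 0 by norm_num)).umin ^ 2 +
        ((bandBounds (show (-4 : ℝ) < -1.1 by norm_num) (show (-1.1 : ℝ) ≤ -0.1 by norm_num) (show (-0.1 : ℝ) < 0 by norm_num)).Dtmin - 2 * A)⁻¹)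

/-- Near/middle boundary slope `κ₀ = 12/(c·(Dt−2A))`, `c = pairSumLowerConst r`: on `κ₀|σ| ≤ |φ|` the radial part of the defect is `≤ (c/4)|φ|`. -/
def valueBridgeKappa (A r : ℝ) : ℝ :=
  12 / (pairSumLowerConst r *
    ((bandBounds (show (-4 : ℝ) < -1.1 by norm_num) (show (-1.1 : ℝ) ≤ -0.1 by norm_num) (show (-0.1 : ℝ) < 0 by norm_num)).Dtmin - 2 * A))

/-- Middle/far boundary `φ₀ = c/(8(msD₂+1))`: on `|φ| ≤ φ₀` the curvature part of the defect is `≤ (c/4)|φ|`. -/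
def valueBridgePhi0 (A₃ A₄ r : ℝ) : ℝ := pairSumLowerConst r / (8 * (msD A₃ A₄ 2 + 1))

/-- **THE `Λ`-FREE PRINCIPAL-VALUE CONSTANT** `π·A₀ + (π/2)·A₁` (`c = pairSumLowerConst r`, `D₀ = Dt_min − 2A`, `W₀ = valueBridgeW0`, `L_W = valueBridgeLW`,
`κ₀ = valueBridgeKappa`, `φ₀ = valueBridgePhi0`): `A₀ = 2cb₁W₀/(c′cφ₀) + 2cb₁L_W/(c′c) + 8cb₂W₀msD₂/(c′c)²` (far + middle constants),
`A₁ = 4κ₀cb₁W₀/(c′c) + 16cb₂W₀/((c′c)²D₀κ₀)` (near core + middle `|σ|/φ²` tail, both against the Cauchy kernel). -/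
def valuePVConst (A A₃ A₄ r cb₁ cb₂ c' : ℝ) : ℝ :=
  π * (2 * cb₁ * valueBridgeW0 A / (c' * pairSumLowerConst r * valueBridgePhi0 A₃ A₄ r) + 2 * cb₁ * valueBridgeLW A A₃ / (c' * pairSumLowerConst r) +
      8 * cb₂ * valueBridgeW0 A * msD A₃ A₄ 2 / (c' * pairSumLowerConst r) ^ 2) +
    π / 2 * (4 * valueBridgeKappa A r * cb₁ * valueBridgeW0 A / (c' * pairSumLowerConst r) +
      16 * cb₂ * valueBridgeW0 A /
        ((c' * pairSumLowerConst r) ^ 2 *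
          ((bandBounds (show (-4 : ℝ) < -1.1 by norm_num) (show (-1.1 : ℝ) ≤ -0.1 by norm_num) (show (-0.1 : ℝ) < 0 by norm_num)).Dtmin - 2 * A) *
          valueBridgeKappa A r))

section Sizes

variable {K : TrigPolyC4v} {A : ℝ} (hA : ∀ p : Momentum, ∀ j ≤ 2, ‖iteratedFDeriv ℝ j (frameShift K) p‖ ≤ A) (hA20 : A ≤ 1 / 20)
  (hd : klCurveD ≤ (bandBounds (show (-4 : ℝ) < -1.1 by norm_num) (show (-1.1 : ℝ) ≤ -0.1 by norm_num)
    (show (-0.1 : ℝ) < 0 by norm_num)).Dtmin - 2 * A)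
  {μ r : ℝ} (hr : 0 < r) (hlo : (-1.1 : ℝ) < μ - r - A) (hhi : μ + r + A < -0.1)
  {A₃ A₄ : ℝ} (hA₃ : ∀ p : Momentum, ‖iteratedFDeriv ℝ 3 (frameShift K) p‖ ≤ A₃)
  (hA₄ : ∀ p : Momentum, ‖iteratedFDeriv ℝ 4 (frameShift K) p‖ ≤ A₄)
include hA hA20 hd hr hlo hhi hA₃ hA₄

/-! ## §1 The weight `W(φ) = J(s₀, π+φ+θ) • ∂_σS_σ(φ)` -/

omit hA20 hA₃ hA₄ hr in
/-- **Size of the weight**: `‖J(s₀,ϑ) • toLp(∂_μu(σ,ϑ)•dir ϑ)‖ ≤ valueBridgeW0 A = π√2/(Dt_min − 2A)²`. -/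
theorem norm_jac_smul_levelVel_le {s₀ σ : ℝ} (hs₀ : |s₀| < r) (hσ : |σ| < r) (ϑ : ℝ) :
    ‖levelChartJac μ K (s₀, ϑ) •
        (WithLp.toLp 2 (deriv (fun m : ℝ => perturbedFermiRadius (fun k : Fin 2 → ℝ => -K.eval k) m ϑ) (μ + σ) • dir ϑ) : Momentum)‖ ≤
      valueBridgeW0 A := by
  set B := bandBounds (show (-4 : ℝ) < -1.1 by norm_num) (show (-1.1 : ℝ) ≤ -0.1 by norm_num) (show (-0.1 : ℝ) < 0 by norm_num) with hBdef
  have hADt : 2 * A < B.Dtmin := by have := klCurveD_pos; linarith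
  have hDt : 0 < B.Dtmin - 2 * A := by linarith
  have hσI : σ ∈ Ioo (-r) r := ⟨(abs_lt.1 hσ).1, (abs_lt.1 hσ).2⟩
  have h1 : (-1.1 : ℝ) < μ + s₀ - A := by have := (abs_lt.1 hs₀).1; linarith
  have h2 : μ + s₀ + A < -0.1 := by have := (abs_lt.1 hs₀).2; linarith
  have hJ0 : 0 < levelChartJac μ K (s₀, ϑ) := by rw [levelChartJac_apply]; exact levelChartJac_pos B hA hADt h1 h2
  have hJle : levelChartJac μ K (s₀, ϑ) ≤ π * Real.sqrt 2 / (B.Dtmin - 2 * A) := by rw [levelChartJac_apply]; exact levelChartJac_le B hA hADt h1 h2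
  rw [norm_smul, Real.norm_eq_abs, abs_of_pos hJ0, valueBridgeW0, ← hBdef, sq, ← div_div, div_eq_mul_inv _ (B.Dtmin - 2 * A)]
  exact mul_le_mul hJle (norm_levelVel_le B hA hADt hlo hhi hσI ϑ) (norm_nonneg _) (by positivity)

omit hA hA20 hd hr hlo hhi hA₃ hA₄ in
/-- `0 ≤ valueBridgeW0 A` whenever `2A < Dt_min` (it is a quotient of nonnegatives; true unconditionally as a square sits downstairs). -/
theorem valueBridgeW0_nonneg (A : ℝ) : 0 ≤ valueBridgeW0 A := by
  unfold valueBridgeW0; positivity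

omit hA20 hA₃ hA₄ hr in
/-- **Angular modulus of the weight**: `‖W(ϑ) − W(ϑ′)‖ ≤ valueBridgeLW A A₃·|ϑ − ϑ′|`. -/
theorem norm_jac_smul_levelVel_sub_le {s₀ σ : ℝ} (hs₀ : |s₀| < r) (hσ : |σ| < r) (ϑ ϑ' : ℝ) :
    ‖levelChartJac μ K (s₀, ϑ) •
          (WithLp.toLp 2 (deriv (fun m : ℝ => perturbedFermiRadius (fun k : Fin 2 → ℝ => -K.eval k) m ϑ) (μ + σ) • dir ϑ) : Momentum) -
        levelChartJac μ K (s₀, ϑ') •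
          (WithLp.toLp 2 (deriv (fun m : ℝ => perturbedFermiRadius (fun k : Fin 2 → ℝ => -K.eval k) m ϑ') (μ + σ) • dir ϑ') : Momentum)‖ ≤
      valueBridgeLW A A₃ * |ϑ - ϑ'| := by
  set B := bandBounds (show (-4 : ℝ) < -1.1 by norm_num) (show (-1.1 : ℝ) ≤ -0.1 by norm_num) (show (-0.1 : ℝ) < 0 by norm_num) with hBdef
  have hADt : 2 * A < B.Dtmin := by have := klCurveD_pos; linarith
  have hDt : 0 < B.Dtmin - 2 * A := by linarith
  have hσI : σ ∈ Ioo (-r) r := ⟨(abs_lt.1 hσ).1, (abs_lt.1 hσ).2⟩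
  have hs₀I : s₀ ∈ Ioo (-r) r := ⟨(abs_lt.1 hs₀).1, (abs_lt.1 hs₀).2⟩
  have h1 : (-1.1 : ℝ) < μ + s₀ - A := by have := (abs_lt.1 hs₀).1; linarith
  have h2 : μ + s₀ + A < -0.1 := by have := (abs_lt.1 hs₀).2; linarith
  set J := levelChartJac μ K (s₀, ϑ) with hJ
  set J' := levelChartJac μ K (s₀, ϑ') with hJ'
  set v : Momentum := WithLp.toLp 2 (deriv (fun m : ℝ => perturbedFermiRadius (fun k : Fin 2 → ℝ => -K.eval k) m ϑ) (μ + σ) • dir ϑ) with hv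
  set v' : Momentum := WithLp.toLp 2 (deriv (fun m : ℝ => perturbedFermiRadius (fun k : Fin 2 → ℝ => -K.eval k) m ϑ') (μ + σ) • dir ϑ') with hv'
  have hJJ : |J - J'| ≤ klJacG B.Dtmin A A₃ 1 * |ϑ - ϑ'| := abs_levelChartJac_sub_le_angle B hA hADt hlo hhi hs₀I A₃ ϑ ϑ'
  have hJ'0 : 0 < J' := by rw [hJ', levelChartJac_apply]; exact levelChartJac_pos B hA hADt h1 h2
  have hJ'le : |J'| ≤ π * Real.sqrt 2 / (B.Dtmin - 2 * A) := by
    rw [abs_of_pos hJ'0, hJ', levelChartJac_apply]; exact levelChartJac_le B hA hADt h1 h2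
  have hvle : ‖v‖ ≤ (B.Dtmin - 2 * A)⁻¹ := norm_levelVel_le B hA hADt hlo hhi hσI ϑ
  have hvv : ‖v - v'‖ ≤ (klJacG B.Dtmin A A₃ 1 / B.umin + π * Real.sqrt 2 / (B.Dtmin - 2 * A) * klJacR1 B.Dtmin A / B.umin ^ 2 +
      (B.Dtmin - 2 * A)⁻¹) * |ϑ - ϑ'| := norm_levelVel_sub_le_angle B hA hADt hlo hhi hσI A₃ ϑ ϑ'
  have hsplit : J • v - J' • v' = (J - J') • v + J' • (v - v') := by rw [sub_smul, smul_sub]; abel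
  rw [hsplit]
  have hG1 : 0 ≤ klJacG B.Dtmin A A₃ 1 := le_trans (abs_nonneg _) (abs_deriv_levelChartJac_le B hA hADt h1 h2 A₃ ϑ)
  calc ‖(J - J') • v + J' • (v - v')‖ ≤ ‖(J - J') • v‖ + ‖J' • (v - v')‖ := norm_add_le _ _
    _ = |J - J'| * ‖v‖ + |J'| * ‖v - v'‖ := by rw [norm_smul, norm_smul, Real.norm_eq_abs, Real.norm_eq_abs]
    _ ≤ klJacG B.Dtmin A A₃ 1 * |ϑ - ϑ'| * (B.Dtmin - 2 * A)⁻¹ +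
          π * Real.sqrt 2 / (B.Dtmin - 2 * A) *
            ((klJacG B.Dtmin A A₃ 1 / B.umin + π * Real.sqrt 2 / (B.Dtmin - 2 * A) * klJacR1 B.Dtmin A / B.umin ^ 2 + (B.Dtmin - 2 * A)⁻¹) *
              |ϑ - ϑ'|) :=
        add_le_add (mul_le_mul hJJ hvle (norm_nonneg _) (by positivity)) (mul_le_mul hJ'le hvv (norm_nonneg _) (by positivity))
    _ = valueBridgeLW A A₃ * |ϑ - ϑ'| := by rw [valueBridgeLW, ← hBdef]; ring

omit hA20 hA₃ hA₄ hr in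
/-- The weight is continuous in the angle. -/
theorem continuous_jac_smul_levelVel {s₀ σ : ℝ} (hs₀ : |s₀| < r) (hσ : |σ| < r) :
    Continuous fun ϑ : ℝ => levelChartJac μ K (s₀, ϑ) •
      (WithLp.toLp 2 (deriv (fun m : ℝ => perturbedFermiRadius (fun k : Fin 2 → ℝ => -K.eval k) m ϑ) (μ + σ) • dir ϑ) : Momentum) := by
  set B := bandBounds (show (-4 : ℝ) < -1.1 by norm_num) (show (-1.1 : ℝ) ≤ -0.1 by norm_num) (show (-0.1 : ℝ) < 0 by norm_num) with hBdef
  have hADt : 2 * A < B.Dtmin := by have := klCurveD_pos; linarith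
  have hσI : σ ∈ Ioo (-r) r := ⟨(abs_lt.1 hσ).1, (abs_lt.1 hσ).2⟩
  have hs₀I : s₀ ∈ Ioo (-r) r := ⟨(abs_lt.1 hs₀).1, (abs_lt.1 hs₀).2⟩
  have h1 : (-1.1 : ℝ) < μ + σ - A := by have := (abs_lt.1 hσ).1; linarith
  have h2 : μ + σ + A < -0.1 := by have := (abs_lt.1 hσ).2; linarith
  have hJ : Continuous fun ϑ : ℝ => levelChartJac μ K (s₀, ϑ) := continuous_levelChartJac_angle B hA hADt hlo hhi hs₀I
  have hJσ : Continuous fun ϑ : ℝ => levelChartJac μ K (σ, ϑ) := continuous_levelChartJac_angle B hA hADt hlo hhi hσI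
  obtain ⟨-, hu, -⟩ := polar_data B hA hADt h1 h2
  have hcoef : Continuous fun ϑ : ℝ => deriv (fun m : ℝ => perturbedFermiRadius (fun k : Fin 2 → ℝ => -K.eval k) m ϑ) (μ + σ) := by
    have hfun : (fun ϑ : ℝ => deriv (fun m : ℝ => perturbedFermiRadius (fun k : Fin 2 → ℝ => -K.eval k) m ϑ) (μ + σ)) = fun ϑ =>
        levelChartJac μ K (σ, ϑ) / perturbedFermiRadius (fun k : Fin 2 → ℝ => -K.eval k) (μ + σ) ϑ :=
      funext fun ϑ => deriv_levelRadius_level_eq_jac_div B hA hlo hhi hσI ϑ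
    rw [hfun]
    exact hJσ.div hu.continuous fun ϑ => (levelRadius_pos B hA h1.le h2.le ϑ).ne'
  have hvec : Continuous fun ϑ : ℝ => (WithLp.toLp 2 (deriv (fun m : ℝ => perturbedFermiRadius (fun k : Fin 2 → ℝ => -K.eval k) m ϑ) (μ + σ) •
      dir ϑ) : Momentum) :=
    (PiLp.continuousLinearEquiv 2 ℝ (fun _ : Fin 2 => ℝ)).symm.continuous.comp (hcoef.smul (contDiff_dir (n := 0)).continuous)
  exact hJ.smul hvec

/-! ## §2 Pointwise bounds of `f(φ) = DB(S_σ(φ))[W(φ)]` -/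

omit hA hA20 hd hr hlo hhi hA₃ hA₄ in
/-- **From the Fréchet majorant to a chart-distance bound**: `‖DB(p)‖ ≤ cb₁·(max(c′‖p‖,Λ))⁻¹`, `ℓ ≤ ‖p‖` ⇒ `‖DB(p)‖ ≤ cb₁·(max(c′ℓ, Λ))⁻¹`. -/
theorem norm_fderiv_le_of_majorant {Bf : Momentum → ℂ} {cb₁ c' Λ : ℝ} (hΛ : 0 < Λ) (hcb₁ : 0 ≤ cb₁)
    (hD1 : ∀ p, ‖fderiv ℝ Bf p‖ ≤ cb₁ * (max (c' * ‖p‖) Λ)⁻¹) {p : Momentum} {ℓ : ℝ} (hc' : 0 ≤ c') (hℓ : ℓ ≤ ‖p‖) :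
    ‖fderiv ℝ Bf p‖ ≤ cb₁ * (max (c' * ℓ) Λ)⁻¹ := by
  refine (hD1 p).trans (mul_le_mul_of_nonneg_left ?_ hcb₁)
  exact inv_anti₀ (lt_max_of_lt_right hΛ) (max_le_max (mul_le_mul_of_nonneg_left hℓ hc') le_rfl)

/-- **Lower comparability at relative angle `π + φ`**: for `|σ| < r` and `φ ∈ (−π, π)`, `pairSumLowerConst r·(|σ| + |φ|) ≤ ‖S_{σ,π+φ,θ}(0)‖`. -/
theorem norm_pairSumPath_pi_add_ge {σ : ℝ} (hσ : |σ| < r) {φ : ℝ} (hφ : φ ∈ Ioo (-π) π) (θ : ℝ) :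
    pairSumLowerConst r * (|σ| + |φ|) ≤ ‖pairSumPath μ K σ (π + φ) θ 0‖ := by
  have hϑ : π + φ ∈ Icc 0 (2 * π) := ⟨by linarith [hφ.1], by linarith [hφ.2]⟩
  have h := norm_pairSumPath_zero_ge hA hA20 hd hr hlo hhi hA₃ hA₄ hσ hϑ θ
  rwa [show π + φ - π = φ by ring] at h

/-- **THE PAIRED BOUND on the middle window.**  `B` even, `C²`, with the two majorants; `|σ| < r`; `φ ∈ (−π,π)`, `φ ≠ 0`, with
`valueBridgeKappa·|σ| ≤ |φ| ≤ valueBridgePhi0`; any weight `W` with `‖W‖ ≤ W₀` and `‖W(φ) − W(φ′)‖ ≤ L_W|φ − φ′|` (`W₀`, `L_W` real parameters).  Then with `S± = S_{σ,π±φ,θ}(0)`: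
`‖DB(S₊)[W(φ)] + DB(S₋)[W(−φ)]‖ ≤ (4cb₂W₀/(c′c)²)·(2|σ|/(Dt−2A) + 2msD₂φ²)/φ² + 2cb₁L_W/(c′c)` (`c = pairSumLowerConst r`). -/
theorem norm_fderiv_pair_le_of_window {Bf : Momentum → ℂ} (hB : ContDiff ℝ 2 Bf) (heven : ∀ p, Bf (-p) = Bf p) {cb₁ cb₂ c' Λ : ℝ} (hc' : 0 < c')
    (hΛ : 0 < Λ) (hcb₁ : 0 ≤ cb₁) (hcb₂ : 0 ≤ cb₂) (hD1 : ∀ p, ‖fderiv ℝ Bf p‖ ≤ cb₁ * (max (c' * ‖p‖) Λ)⁻¹)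
    (hD2 : ∀ p, ‖iteratedFDeriv ℝ 2 Bf p‖ ≤ cb₂ * ((max (c' * ‖p‖) Λ) ^ 2)⁻¹) {σ : ℝ} (hσ : |σ| < r) (θ : ℝ) {W₀ LW : ℝ}
    {W : ℝ → Momentum} (hWle : ∀ φ, ‖W φ‖ ≤ W₀) (hWlip : ∀ φ φ', ‖W φ - W φ'‖ ≤ LW * |φ - φ'|) {φ : ℝ} (hφ : φ ∈ Ioo (-π) π) (hφ0 : φ ≠ 0)
    (hnear : valueBridgeKappa A r * |σ| ≤ |φ|) (hfar : |φ| ≤ valueBridgePhi0 A₃ A₄ r) :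
    ‖(fderiv ℝ Bf (pairSumPath μ K σ (π + φ) θ 0)) (W φ) + (fderiv ℝ Bf (pairSumPath μ K σ (π + -φ) θ 0)) (W (-φ))‖ ≤
      4 * cb₂ * W₀ / (c' * pairSumLowerConst r) ^ 2 *
          ((2 * |σ| / ((bandBounds (show (-4 : ℝ) < -1.1 by norm_num) (show (-1.1 : ℝ) ≤ -0.1 by norm_num) (show (-0.1 : ℝ) < 0 by norm_num)).Dtmin -
              2 * A) + 2 * msD A₃ A₄ 2 * φ ^ 2) / φ ^ 2) +
        2 * cb₁ * LW / (c' * pairSumLowerConst r) := by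
  set B := bandBounds (show (-4 : ℝ) < -1.1 by norm_num) (show (-1.1 : ℝ) ≤ -0.1 by norm_num) (show (-0.1 : ℝ) < 0 by norm_num) with hBdef
  have hADt : 2 * A < B.Dtmin := by have := klCurveD_pos; linarith
  have hDt : 0 < B.Dtmin - 2 * A := by linarith
  set c := pairSumLowerConst r with hcdef
  have hc : 0 < c := pairSumLowerConst_pos hr
  have h0r : |(0 : ℝ)| < r := by simpa using hr
  have hm0 : 0 ≤ msD A₃ A₄ 2 :=
    le_trans (norm_nonneg _) (norm_iteratedDeriv_levelPoint_le hA hA20 hd hlo hhi hA₃ hA₄ h0r (i := 2) (by norm_num) (by norm_num) θ)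
  have hφ0' : 0 < |φ| := abs_pos.2 hφ0
  -- the two points and the defect
  set Sp := pairSumPath μ K σ (π + φ) θ 0 with hSp
  set Sm := pairSumPath μ K σ (π + -φ) θ 0 with hSm
  have hSm' : Sm = pairSumPath μ K σ (π - φ) θ 0 := by rw [hSm, sub_eq_add_neg]
  set Δ := Sp + Sm with hΔ
  -- lower comparability
  have hnegφ : -φ ∈ Ioo (-π) π := ⟨by linarith [hφ.2], by linarith [hφ.1]⟩
  have hSp_ge : c * |φ| ≤ ‖Sp‖ := by
    have h := norm_pairSumPath_pi_add_ge hA hA20 hd hr hlo hhi hA₃ hA₄ hσ hφ θ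
    rw [← hcdef] at h
    nlinarith [abs_nonneg σ, hc]
  -- evenness: `DB(Sm) = −DB(Sp − Δ)`
  have hdiffB : Differentiable ℝ Bf := hB.differentiable (by norm_num)
  have hDBm : fderiv ℝ Bf Sm = -fderiv ℝ Bf (Sp - Δ) := by
    have : Sm = -(Sp - Δ) := by rw [hΔ]; abel
    rw [this, fderiv_neg_of_even hdiffB heven]
  -- split
  have hsplit : (fderiv ℝ Bf Sp) (W φ) + (fderiv ℝ Bf Sm) (W (-φ)) =
      (fderiv ℝ Bf Sp - fderiv ℝ Bf (Sp - Δ)) (W (-φ)) + (fderiv ℝ Bf Sp) (W φ - W (-φ)) := by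
    have e1 : (fderiv ℝ Bf Sp - fderiv ℝ Bf (Sp - Δ)) (W (-φ)) = fderiv ℝ Bf Sp (W (-φ)) - fderiv ℝ Bf (Sp - Δ) (W (-φ)) := rfl
    have e2 : (-fderiv ℝ Bf (Sp - Δ)) (W (-φ)) = -(fderiv ℝ Bf (Sp - Δ) (W (-φ))) := rfl
    rw [hDBm, e1, e2, map_sub]; ring
  rw [hsplit]
  -- second term
  have hT2 : ‖(fderiv ℝ Bf Sp) (W φ - W (-φ))‖ ≤ 2 * cb₁ * LW / (c' * c) := by
    have hDB : ‖fderiv ℝ Bf Sp‖ ≤ cb₁ * (max (c' * (c * |φ|)) Λ)⁻¹ := norm_fderiv_le_of_majorant hΛ hcb₁ hD1 hc'.le hSp_ge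
    have hmax : (max (c' * (c * |φ|)) Λ)⁻¹ ≤ (c' * c * |φ|)⁻¹ := by
      rw [← mul_assoc]; exact inv_anti₀ (by positivity) (le_max_left _ _)
    have hWd : ‖W φ - W (-φ)‖ ≤ LW * (2 * |φ|) := by
      have h := hWlip φ (-φ); rwa [sub_neg_eq_add, ← two_mul, abs_mul, abs_two] at h
    calc ‖(fderiv ℝ Bf Sp) (W φ - W (-φ))‖ ≤ ‖fderiv ℝ Bf Sp‖ * ‖W φ - W (-φ)‖ := ContinuousLinearMap.le_opNorm _ _
      _ ≤ cb₁ * (c' * c * |φ|)⁻¹ * (LW * (2 * |φ|)) :=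
          mul_le_mul (hDB.trans (mul_le_mul_of_nonneg_left hmax hcb₁)) hWd (norm_nonneg _) (by positivity)
      _ = 2 * cb₁ * LW / (c' * c) := by field_simp
  -- first term: mean value for `DB` on the reflection segment
  have hΔle : ‖Δ‖ ≤ 2 * |σ| / (B.Dtmin - 2 * A) + 2 * msD A₃ A₄ 2 * φ ^ 2 := by
    rw [hΔ, hSm']; exact norm_pairSumPath_reflDefect_le hA hA20 hd hr hlo hhi hA₃ hA₄ hσ φ θ
  have hseg : ∀ ξ ∈ segment ℝ Sp (Sp - Δ), c * |φ| / 2 ≤ ‖ξ‖ := by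
    intro ξ hξ
    rw [segment_eq_image'] at hξ
    obtain ⟨t, ht, rfl⟩ := hξ
    have hgeo := norm_pairSumPath_sub_smul_reflDefect_ge hA hA20 hd hr hlo hhi hA₃ hA₄ hσ (le_of_lt (abs_lt.2 ⟨hφ.1, hφ.2⟩)) θ ht
    rw [← hSm', ← hSp, ← hΔ, ← hcdef] at hgeo
    have hform : Sp + t • (Sp - Δ - Sp) = Sp - t • Δ := by rw [sub_sub_cancel_left, smul_neg, sub_eq_add_neg]
    show c * |φ| / 2 ≤ ‖Sp + t • (Sp - Δ - Sp)‖
    rw [hform]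
    -- the two smallness conditions of the window
    have hrad : 3 * |σ| / (B.Dtmin - 2 * A) ≤ c * |φ| / 4 := by
      have hk : valueBridgeKappa A r = 12 / (c * (B.Dtmin - 2 * A)) := by rw [valueBridgeKappa, ← hBdef, ← hcdef]
      rw [hk, div_mul_eq_mul_div, div_le_iff₀ (by positivity : (0 : ℝ) < c * (B.Dtmin - 2 * A))] at hnear
      rw [div_le_div_iff₀ hDt (by norm_num : (0 : ℝ) < 4)]
      linarith
    have hcurv : 2 * msD A₃ A₄ 2 * φ ^ 2 ≤ c * |φ| / 4 := by
      have hp : valueBridgePhi0 A₃ A₄ r = c / (8 * (msD A₃ A₄ 2 + 1)) := by rw [valueBridgePhi0, ← hcdef]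
      rw [hp, le_div_iff₀ (by positivity)] at hfar
      have h1 : msD A₃ A₄ 2 * |φ| ≤ c / 8 := by
        rw [le_div_iff₀ (by norm_num : (0 : ℝ) < 8)]
        nlinarith [hfar, hm0, abs_nonneg φ]
      calc 2 * msD A₃ A₄ 2 * φ ^ 2 = 2 * (msD A₃ A₄ 2 * |φ|) * |φ| := by rw [← sq_abs]; ring
        _ ≤ 2 * (c / 8) * |φ| := by gcongr
        _ = c * |φ| / 4 := by ring
    linarith
  have hC1 : ContDiff ℝ 1 (fderiv ℝ Bf) := hB.fderiv_right (by norm_num)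
  have hdiffDB : ∀ ξ ∈ segment ℝ Sp (Sp - Δ), DifferentiableAt ℝ (fderiv ℝ Bf) ξ := fun ξ _ => (hC1.differentiable (by norm_num)) ξ
  have hboundDB : ∀ ξ ∈ segment ℝ Sp (Sp - Δ), ‖fderiv ℝ (fderiv ℝ Bf) ξ‖ ≤ cb₂ * ((c' * (c * |φ| / 2)) ^ 2)⁻¹ := by
    intro ξ hξ
    have hξ' := hseg ξ hξ
    rw [← norm_iteratedFDeriv_one (𝕜 := ℝ), norm_iteratedFDeriv_fderiv]
    refine (hD2 ξ).trans (mul_le_mul_of_nonneg_left ?_ hcb₂)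
    have hpos : 0 < c' * (c * |φ| / 2) := by positivity
    refine inv_anti₀ (by positivity) (pow_le_pow_left₀ hpos.le ?_ 2)
    exact le_max_of_le_left (mul_le_mul_of_nonneg_left hξ' hc'.le)
  have hMVT := (convex_segment Sp (Sp - Δ)).norm_image_sub_le_of_norm_fderiv_le hdiffDB hboundDB (left_mem_segment ℝ Sp (Sp - Δ))
    (right_mem_segment ℝ Sp (Sp - Δ))
  rw [sub_sub_cancel_left, norm_neg] at hMVT
  have hT1 : ‖(fderiv ℝ Bf Sp - fderiv ℝ Bf (Sp - Δ)) (W (-φ))‖ ≤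
      4 * cb₂ * W₀ / (c' * c) ^ 2 * ((2 * |σ| / (B.Dtmin - 2 * A) + 2 * msD A₃ A₄ 2 * φ ^ 2) / φ ^ 2) := by
    have hnorm : ‖fderiv ℝ Bf Sp - fderiv ℝ Bf (Sp - Δ)‖ ≤ cb₂ * ((c' * (c * |φ| / 2)) ^ 2)⁻¹ * ‖Δ‖ := by
      rw [← norm_neg, neg_sub]; exact hMVT
    calc ‖(fderiv ℝ Bf Sp - fderiv ℝ Bf (Sp - Δ)) (W (-φ))‖ ≤ ‖fderiv ℝ Bf Sp - fderiv ℝ Bf (Sp - Δ)‖ * ‖W (-φ)‖ :=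
          ContinuousLinearMap.le_opNorm _ _
      _ ≤ cb₂ * ((c' * (c * |φ| / 2)) ^ 2)⁻¹ * (2 * |σ| / (B.Dtmin - 2 * A) + 2 * msD A₃ A₄ 2 * φ ^ 2) * W₀ :=
          mul_le_mul (hnorm.trans (mul_le_mul_of_nonneg_left hΔle (by positivity))) (hWle _) (norm_nonneg _) (by positivity)
      _ = 4 * cb₂ * W₀ / (c' * c) ^ 2 * ((2 * |σ| / (B.Dtmin - 2 * A) + 2 * msD A₃ A₄ 2 * φ ^ 2) / φ ^ 2) := by
          rw [← sq_abs φ]; field_simp; ring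
  exact (norm_add_le _ _).trans (add_le_add hT1 hT2)

end Sizes

end Summit.HubbardSuperconductivity.HubbardSuperconductivity.Theorems.C4a

end
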